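import Mathlib
import HarnessLib
import HarnessLib.Audit
import Summits.Parity.Statement
import Literature.NumberTheory.Sieve.PolynomialCongruences

/-!
Route: KloostermanFractions

CLOSED (retired) 2026-08-15T13:49:56Z by operator:999:1257524 — reason: not-a-thesis: assembly does not conclude the sub-problem Statement — note: D-0027 §2.1 audit (human 2026-08-15: routes that do not decide the summit are removed): the assembly concludes `Literature.NumberTheory.Sieve.HardyLittlewoodConjE`, not the sub-problem statement; a NEW conforming route may be opened from the same idea (generated `closes : … → _root_.BatemanHorn`).. The file is kept as the record of this route; refuted decls are indexed as negative knowledge (`ledger negatives`).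

# Route KloostermanFractions — the HL-E log-window is small-root BV beyond sqrt X, i.e. bilinear
forms in root Kloosterman fractions over Z[i]

It suffices to show X = RootLevelBeyondHalf ∧ TypeIIPolylog ∧ CofactorLog for f = X²+1
(Hardy–Littlewood E, the first
conjunct-slice of BatemanHorn; reach = `Literature.NumberTheory.Sieve.HardyLittlewoodConjE`, exactly
as the shared assembly
stmt-Parity-0647 of UnimodularColumns/QuadraticRoots). Writing Λ(n²+1) = Σ_{de=n²+1} μ(d) log e and
A_d(x) = #{n ≤ x : d ∣ n²+1} =
xρ(d)/d + r_d(x): (i) RootLevelBeyondHalf = signed level of distribution X^{1/2+δ} for the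
small-root counts a_k(X) = #{ℓ ≤ X : k ∣ ℓ²+1},
k ~ K ≍ X^{1±δ}, over moduli with a marked prime factor p ~ P ∈ [X^{1/2−δ}, X^{1/2+δ}] (the residue
of the window (W) that no printed
method reaches: Hooley/Deshouillers–Iwaniec/de la Bretèche–Drappeau/Grimmelt–Merikoski all stop at d
≤ X^{1/2−o(1)}); its ENGINE form is
the rank-2 crux RootFractionsBound — after Poisson in ℓ and CRT, e(hN/(pr)) = e(hν_p r̄/p)·e(hν_r
p̄/r) is a product of two Kloosterman
FRACTIONS with root numerators, ν_r ↔ a primitive Gaussian integer of norm r, and the p-sum outside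
|·| is the Duke–Friedlander–Iwaniec
1997 / Bettin–Chandee regime (nontrivial at M = N, where every large-sieve/kernel method is void);
(ii) TypeIIPolylog = Grimmelt–Merikoski's
Type II (N ≤ X^{1/3}) with (log X)^{−A} instead of X^{o(1)} losses; (iii) CofactorLog = Möbius
randomness of the cofactor (n²+1)/e >
x(log x)^C on average over e ≤ x(log x)^{−C} (the parity atom, named not attacked). Given the
in-print TypeIBelowHalf (GM Thm 1.4) and
RootMainTerms (PNT for ℚ(i), provable now), a Harman-sieve decomposition of μ(d) on the LOG-window d
∈ [x(log x)^{−C}, x(log x)^{C}] plus the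
Λ = μ∗log bookkeeping give HL-E. Card realised: gaussian-kloosterman-fractions-window (spine; its K1
= RootFractionsBound, K2 =
FractionsToTypeI, K4 = WindowFromTypeInfo); it also types crux C3 of card
unimodular-mobius-gm-continuity (= RootLevelBeyondHalf).
Lean: `RootLevelBeyondHalf ∧ TypeIIPolylog ∧ CofactorLog`

## Assembly
Assembly = HLEFromLogWindow ∘ WindowFromTypeInfo (checked sorry-free as `assembly_of_glue` in the
planner's Sketch.lean: from
RootLevelBeyondHalf, TypeIIPolylog, TypeIBelowHalf get LogWindow; from LogWindow, CofactorLog,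
RootMainTerms get HL-E). The two glue
pieces are filed as supports so refuters can attack the bookkeeping now; RootFractionsBound feeds in
through FractionsToTypeI. Reach: the
X²+1 slice `Literature.NumberTheory.Sieve.HardyLittlewoodConjE` of BatemanHorn (same codomain as
stmt-Parity-0647); general quadratic f
and deg ≥ 3 are not claimed.

Rationale: WHY THIS LINE. The (W)-crux of QuadraticRoots/UnimodularColumns (stmt-Parity-0648, all A, window up
to x^{1+η}) hides two different things: a modulus-side
statement near the diagonal D ≍ x, where Duke–Friedlander–Iwaniec Type-I/II technology for roots of
quadratic congruences lives
(DukeFriedlanderIwaniec1995; arXiv:2505.00493 Thms 1.4–1.5; Merikoski2022 Props 3–4;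
FordMaynard2024PrimeSieves Thm 2.5), and a cofactor/parity
statement at the top of the window; this route cuts exactly at the log-window, so that the modulus
side needs ONE new estimate: Type I for
small roots at level X^{1/2}·(quasi-polylog), i.e. beyond the diagonal d = √k where DI/dlBD (level
x^{(32−7α)/50} = x^{1/2} at α = 1,
Merikoski2022 p.5) and GM (D ≤ X^{1/2−o(1)}, arXiv:2505.00493 p.4) stop for the same reason the
large sieve stops at Q = √x
(Literature.Barriers.Parity.LargeSieveLevelHalf). The imported area is the Kloosterman-FRACTION
technology (DukeFriedlanderIwaniec1997,
BettinChandee2018, Wright arXiv:2604.25177): counting/amplification inequalities for Σ α_m β_n e(a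
m̄/n) that save a power at M = N with
arbitrary coefficients, already used as an 'R*-on-average' substitute to push levels of distribution
past x^{1/2} WITH absolute values
(FouvryRadziwill2022 Cor. 1.1: x^{1/2+1/66}); the dictionary is exact — roots N mod pr ↔ (ν_p,
primitive ideal 𝔯 ⊂ ℤ[i]),
e(hN/pr) = e(hν_p r̄/p)e(hν_r p̄/r) — and the one new feature (numerators entangled with the roots)
is isolated in the rank-2 crux, with a one-page
falsification test attached. Nothing in the negatives index (empty) or in prior routes types a
beyond-√X modulus-side statement; UnimodularColumns'
UnimodularMobius is the qualitative D ≍ x statistic (provable from GM + FM-continuity per its own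
audit), not the quantitative residue.

RANKED CRUXES. #0 Target (target) — X = RootLevelBeyondHalf ∧ TypeIIPolylog ∧ CofactorLog (see §
Thesis); with the supports TypeIBelowHalf (in print) and RootMainTerms (provable) it gives
HardyLittlewoodConjE by the Assembly. (why it might fail: RootLevelBeyondHalf is the n²+1 analogue
of a beyond-√x level for a structured residue system (open in every setting) and CofactorLog is the
parity atom; either failing sinks X. The assembly also leans on the unformalised GM Thm 1.4
(TypeIBelowHalf).) [arXiv:2505.00493, DukeFriedlanderIwaniec1997, FouvryRadziwill2022,
FordMaynard2024PrimeSieves, SawinShusterman2022]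
#2 RootFractionsBound (crux) — ENGINE (card K1, typed over ℤ). ∃ δ > 0: for X ≥ X₀, K ∈ [X^{1−δ},
X^{1+δ}], P ∈ [X^{1/2−δ}, X^{1/2+δ}], K ≤ K' ≤ 2K, 0 ≤ T ≤ X, 1 ≤ t ≤ X^δ, 0 < |h| ≤ X^δ: Σ_{p ∈
(P,2P] prime} Σ_{a mod p, a² ≡ −1} | Σ_{r : t ∣ r, K < pr ≤ K'} Σ_{N mod pr : N² ≡ −1 (pr), N ≡ a
(p)} e(h(N − T)/(pr)) | ≤ K·X^{−δ} (trivial ≍ K/(t log P)). By CRT and reciprocity the phase is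
e(hν_p r̄/p)·e(hν_r p̄/r) up to a smooth factor: a bilinear form in Kloosterman FRACTIONS with root
numerators, outer variable = Gaussian prime π (p = N π, a = ι_π(i)), inner variable = primitive
Gaussian integer of norm r; |·| outside = arbitrary coefficients on π: the DFI-1997/Bettin–Chandee
shape at the balanced point P ≍ K/P. Implies RootLevelBeyondHalf (support FractionsToTypeI, Vaaler).
[difficulty: open-problem] (why it might fail: The numerator is entangled with BOTH variables (h(ν_r
− ν_p)p̄/r): DFI97/BC need a free numerator, and graph-supported numerators can kill all
cancellation (a_m = m gives e(1/n)); only the arithmetic of the roots can save it, and the ℤ[i]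
lattice count may lose R^{1/2}.) [DukeFriedlanderIwaniec1997, BettinChandee2018,
FouvryRadziwill2022, arXiv:2604.25177, DukeFriedlanderIwaniec1995,
Summits/Parity/BatemanHorn/Ideas/gaussian-kloosterman-fractions-window.md]
#3 RootLevelBeyondHalf (crux) — INTERFACE (card C3 of unimodular-mobius-gm-continuity, made honest:
power room, signed over primes). ∃ δ > 0: for X ≥ X₀, K ∈ [X^{1−δ}, X^{1+δ}], K ≤ K' ≤ 2K, P ∈
[X^{1/2−δ}, X^{1/2+δ}], P ≤ P' ≤ 2P, 1 ≤ t ≤ X^δ: | Σ_{p ∈ (P,P'] prime} Σ_{k ∈ (K,K'], pt ∣ k} (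
#{1 ≤ ℓ ≤ X : k ∣ ℓ²+1} − X ρ(k)/k ) | ≤ X^{1−δ}, ρ = polyRootCountMod(X²+1) (trivial ≍ X/log X).
Signed level of distribution X^{1/2+δ} for the small-root sequence over moduli with a marked prime
factor of size ≈ √K — the exact Type-I input the Harman-sieve glue needs for the balanced semiprimes
d = (tiny)·q·m'. Every printed method stops at prime/all moduli ≤ X^{1/2−o(1)}. [deps:
RootFractionsBound] [difficulty: open-problem] (why it might fail: It is the n²+1 analogue of
'primes to prime moduli beyond √x with a fixed residue' (open; BFI reach x^{1/2+o(1)} with |·|, no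
power); Hooley/DI/dlBD (x^{(32−7α)/50}=x^{1/2} at α=1) and GM (D ≤ X^{1/2−o(1)}) all stop exactly
here; a power saving may simply be false at P = X^{1/2+δ}.) [arXiv:2505.00493, Merikoski2022,
DeshouillersIwaniec1982, BombieriFriedlanderIwaniecActa1986, FordMaynard2024PrimeSieves,
DukeFriedlanderIwaniec1995]
#4 TypeIIPolylog (crux) — Grimmelt–Merikoski's Type II (arXiv:2505.00493 Thm 1.5, h = a = 1) with
POLYLOG losses down to tiny N: ∀ A, C > 0 ∃ B, X₀: for X ≥ X₀, K ∈ [X(log X)^{−C}, X(log X)^{C}],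
exp((log X)^{2/3}) ≤ N ≤ X^{1/3}(log X)^{−B}, MN = K, real 1-bounded α, β supported on squarefrees:
| Σ_{m ~ M} Σ_{n ~ N} α_m β_n ( #{ℓ ≤ X : mn ∣ ℓ²+1} − Xρ(mn)/(mn) ) | ≤ X(log X)^{−A}. GM give ≺≺
M^{1/2}X^{1/2} + M^{1/4}NX^{1/2}(1 + X/(M^{1/2}N²))^θ, i.e. saving min(N^{1/2}, (X/N³)^{c}) up to
X^{o(1)}; the crux is to make the loss (log X)^{O(1)} (or anything below exp(½(log X)^{2/3})).
[difficulty: L] (why it might fail: GM absorb the modulus average by a POINTWISE divisor bound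
(their ≺≺ hides X^{o(1)} = exp(O(log X/log log X))); polylog losses need divisor sums on average
inside the automorphic-kernel count, uniformly for N as small as exp((log X)^{2/3}) — may fail
structurally.) [arXiv:2505.00493, Merikoski2022, DukeFriedlanderIwaniec1995]
#5 CofactorLog (crux) — The parity atom, correctly quantified (replaces the vacuous stmt-Parity-0649
shape: here C, δ are coupled to nothing else and every admissible C leaves inner sums of length ≥
(log x)^C ρ(e)): ∃ C ≥ 0, δ > 0, x₀: for x ≥ x₀, Σ_{e ≤ 2x(log x)^{−C}} | Σ_{n ≤ x, e ∣ n²+1, n²+1 >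
e·x(log x)^C} μ((n²+1)/e) | ≤ x(log x)^{−1−δ} (trivial ≍ x log x; random model needs C > 2 + 2δ).
Covers every divisor d = (n²+1)/e above the log-window, including the near-diagonal range d ∈ [x(log
x)^C, x^{1+η}] that (W) of QuadraticRoots assigned to the modulus side. [difficulty: open-problem]
(why it might fail: It is the parity atom: μ of the cofactor (n²+1)/e ≥ x(log x)^C along ρ(e) root
classes with (log x)^{2+δ} saving over trivial — Chowla-type for an irreducible quadratic; no
Type-I/II mechanism exists (FordMaynardLowLevel, c = 1/2); only F_q[t] analogues are known.)
[SawinShusterman2022, Harman2007, FordMaynard2024PrimeSieves,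
Literature.Barriers.Parity.SelbergParityBarrier, Literature.Barriers.Parity.FordMaynardLowLevel]
#9 TypeIBelowHalf (support) — Type I BELOW the diagonal, sharp form of Grimmelt–Merikoski Thm 1.4 (h
= a = 1; also de la Bretèche–Drappeau = Merikoski2022 Prop. 3 at α = 1): ∀ ε > 0 ∃ δ > 0, X₀: for X
≥ X₀, K ∈ [X^{1−δ}, X^{1+δ}], K ≤ K' ≤ 2K, 1 ≤ D ≤ X^{1/2−ε}: Σ_{d ≤ D} | Σ_{k ∈ (K,K'], d ∣ k} (
#{ℓ ≤ X : k ∣ ℓ²+1} − Xρ(k)/k ) | ≤ X^{1−δ}. In print (GM: ≺≺ D X^{1/2}(1+X/D²)^θ, θ = 7/64); sharp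
↔ smooth cutoffs cost X^{1−δ'}. To be vendored as a Literature named fact and used as hypothesis;
needed by the glue for the tiny Legendre moduli and for marked primes q ≤ X^{1/2−ε}. [difficulty: L]
[arXiv:2505.00493, Merikoski2022, DeshouillersIwaniec1982, Hooley1976]
#9 RootMainTerms (support) — PNT(ℚ(i))-strength main-term inputs, ρ = polyRootCountMod(X²+1): ∀ A >
0 ∃ C: for y ≥ 2, |Σ_{d ≤ y} μ(d)ρ(d)/d| ≤ C(log y)^{−A} and |Σ_{d ≤ y} μ(d)ρ(d) log d/d +
hardyLittlewoodEConst| ≤ C(log y)^{−A} (Σ_d μ(d)ρ(d)d^{−s} = ∏_p(1 − ρ(p)p^{−s}) = E(s)/ζ(s), E(1) =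
ordered ∏_p (1−1/p)^{−1}(1−ρ(p)/p) = hardyLittlewoodEConst; μρ = μ·(1∗χ₋₄) on odd squarefrees, so
both follow from Literature.NumberTheory.LFunctions.SiegelWalfiszMoebius_holds by the hyperbola
method + Abel summation). Provable now (laborious). [difficulty: provable-now]
[MontgomeryVaughan2007, BatemanHorn1962,
Literature.NumberTheory.LFunctions.SiegelWalfiszMoebius_holds,
Literature.NumberTheory.Sieve.tendsto_hardyLittlewoodE_partial_holds]
#9 LogWindow (support) — The LOG-window Möbius statement (the part of (W) this route makes precise),
all heights, sub-dyadic: ∀ C > 0 ∃ x₀: for x ≥ x₀, x(log x)^{−C} ≤ D ≤ x(log x)^{C}, D ≤ D' ≤ 2D: |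
Σ_{D<d≤D'} μ(d)( #{n ≤ x : d ∣ n²+1} − xρ(d)/d ) | ≤ x(log x)^{−3/2}. Exponent 3/2 (not all A): the
Harman-sieve boundary slivers at X^{1/3±o(1)} cost x(log log x)²/(log x)², and 3/2 suffices for HL-E
because the window has only O(log log x) dyadic blocks. Follows from RootLevelBeyondHalf +
TypeIIPolylog + TypeIBelowHalf (support WindowFromTypeInfo); qualitatively (o(x)) it is GM +
Ford–Maynard continuity at (½, 0, ⅓). [difficulty: L] [FordMaynard2024PrimeSieves, arXiv:2505.00493,
Harman2007, DukeFriedlanderIwaniec1995]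
#9 FractionsToTypeI (support) — Dual ⇒ primal (card K2): RootFractionsBound → RootLevelBeyondHalf.
#{ℓ ≤ X : ℓ ≡ N (k)} − X/k = ψ(−N/k) − ψ((X−N)/k) exactly (ρ(k)X/k is the exact mean; roots pair N ↔
k−N), Vaaler/Erdős–Turán truncation at H = X^{2δ'} (tail ≪ K/(tH)), frequencies e(h(N−T)/k) for T ∈
{0, X} = the T-twist of the crux, splitting by the root a mod p and the triangle inequality;
sub-dyadic (P,P'], (K,K'] by differencing/short ranges at power cost. [difficulty: M] [Vaaler1985,
MontgomeryVaughan2007, Hooley1976]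
#9 WindowFromTypeInfo (support) — Harman-sieve glue (card K4): RootLevelBeyondHalf → TypeIIPolylog →
TypeIBelowHalf → LogWindow. Decompose squarefree d ~ D ≍ x(log x)^{±C} by factorisation type with z
= exp((log X)^{2/3}): a sub-product in [z, X^{1/3}(log X)^{−B}] ⇒ Type II (coupling P⁻(m) ≥ q
removed on (log X)^{A+1} short q-ranges); else d = s·(≤ 3 primes > X^{1/3}(log)^{−B}), s < z: one
prime ⇒ sieve it (Legendre to z truncated at z^{10 log log X} by Rankin: TypeIBelowHalf; Buchstab
primes in the Type-II range: Type II; larger ⇒ two primes); two primes q ≤ m' ⇒ modulus s·e'·q with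
q ≤ √K(log)^{C/2} ≤ X^{1/2+δ}: RootLevelBeyondHalf (signed over prime q, |·| over the X^{o(1)} tiny
parts) or TypeIBelowHalf when q ≤ X^{1/2−ε}; three primes ≍ X^{1/3} ⇒ boundary sliver of mass ≪
x(log log x)²/(log x)² < x(log x)^{−3/2}. Positive density/divisor-boundedness of a_k is what makes
(½, 0⁺, ⅓) work (FM Thm 2.5, 'DFI where positive density was vital'). [difficulty: XL] [Harman2007,
FordMaynard2024PrimeSieves, DukeFriedlanderIwaniec1995, arXiv:2505.00493]
#9 HLEFromLogWindow (support) — HL-E bookkeeping: LogWindow → CofactorLog → RootMainTerms →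
HardyLittlewoodConjE. With Y = x(log x)^C (C from CofactorLog): Σ_{n≤x} Λ(n²+1) = Σ_{d≤Y} μ(d)
Σ_{n≤x, d∣n²+1} log((n²+1)/d) + Σ_{n≤x} Σ_{e∣n²+1, n²+1>eY} μ((n²+1)/e) log e; second part ≤ log x ·
CofactorLog-sum = o(x); first part: d ≤ x(log x)^{−4} trivially (|r_d(t)| ≤ 2ρ(d)), d ∈ log-window
by LogWindow at heights t ∈ [x(log x)^{−4}, x] (partial summation of log(t²+1), sub-dyadic blocks
against log d; O(log log x) blocks × O(x(log x)^{−1/2})) and Σ_{n≤t} τ(n²+1) ≪ t(log t)² below; main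
terms x·Σ_{d≤Y} μρ/d·(2 log x + O(1)) − x Σ_{d≤Y} μρ log d/d = Hx + o(x) by RootMainTerms, H =
hardyLittlewoodEConst; then Λ → prime count by partial summation (prime powers negligible), and
HardyLittlewoodConjE with C = hardyLittlewoodEConst via tendsto_hardyLittlewoodE_partial_holds.
[difficulty: L] [BatemanHorn1962, Hooley1976, MontgomeryVaughan2007,
Literature.NumberTheory.Sieve.tendsto_hardyLittlewoodE_partial_holds]

TWO-LAYER PLAN. Foreseen glued splits (nothing filed beyond the supports above): RootFractionsBound
⇐ ZDiagonalForm (the un-entangled ℤ-model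
Σ_p |Σ_r β(r) Σ_{ν_r} e(hν_r p̄/r)| = root Weyl sums at frequency hp̄, DFI97 counting over ℤ[i]) →
EntangledNumerator (absorbing e(hν_p r̄/p),
i.e. (π, u_π) as a point of Im(π u) = 1) → RootFractionsBound; TypeIIPolylog ⇐ (GM kernel bound with
divisor sums on average) → (small-N
dispersion, N ≤ X^{ε}) → TypeIIPolylog; Assembly ⇐ WindowFromTypeInfo → HLEFromLogWindow → Assembly
(already typed). CofactorLog is not
decomposed here (parity atom; other routes/cards own it).

KILL CRITERIA. RootLevelBeyondHalf refuted (an Ω(X^{1−o(1)}) bias of the signed prime-moduli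
discrepancy, or numerics showing no power decay) closes the
route `refuted:RootLevelBeyondHalf` and refutes RootFractionsBound with it (FractionsToTypeI).
RootFractionsBound refuted alone (e.g. the
DFI97/BC counting provably degenerates for root numerators while the signed sum still cancels) ⇒
pivot: restate rank 2 for another engine,
keep the interface. TypeIIPolylog refuted (X^{o(1)} structural below N = X^{ε}) ⇒ pivot to an
o(x)-quality window, which no longer reaches
HL-E through this assembly ⇒ close `exhausted` unless a Siegel–Walfisz-type input for roots appears.
CofactorLog refuted (a genuine
μ-bias of large cofactors on average over e) kills every Λ = μ∗log route to HL-E (this one,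
QuadraticRoots, UnimodularColumns): close.
LogWindow proved elsewhere moots ranks 2–4 for HL-E (the route then reduces to CofactorLog) but
RootLevelBeyondHalf stays wanted.

NOT DECOMPOSED YET. The ℤ[i] lattice-point/spacing lemma of the DFI97 transplant and the treatment
of the entangled numerator (children of rank 2, above);
the power window of (W) up to x^{1+η} (would need level X^{1/2+η/2} AND Type II beyond X^{(1−η)/3}:
deliberately replaced by the
log-window + CofactorLog cut); Type-I with |·| over ALL moduli q ≤ X^{1/2+δ} (EH-shaped, stronger
than needed, not filed); general
quadratic f (orders of ℚ(√−D), class number > 1), deg ≥ 3 (route CubicRoots), k ≥ 2 systems and the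
uniformity over systems that
BatemanHornConjecture proper needs; sharp↔smooth conversions and the Λ → π passage (inside the glue
items).

CHEAPEST FALSIFIER. (1) kit numerics a refuter can run in minutes: factor n²+1 for n ≤ 2·10^7 (sieve
by roots), tabulate a_k(X) for k ≤ 4·10^7, and evaluate
S(X,P) = Σ_{p~P} Σ_{k~X, p∣k} (a_k(X) − Xρ(k)/k) for X = 10^5…10^7, P = X^{1/2}·2^j, j = −2…3:
RootLevelBeyondHalf predicts |S| ≤ X^{1−δ}
uniformly in j ≥ 0 (random model X^{3/4}); a plateau |S| ≍ X/log X at j ≥ 1 kills ranks 2–3. (2)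
theory, one page: does the Bettin–Chandee
bound for Σ_a ν_a Σ_m Σ_n α_m β_n e(a m̄/n) degenerate when ν is supported on the graph a = ν_m
(root of −1 mod m)? The card's audit says
yes for a = m; for a = ν_m the pure-ν_p part is an incomplete Kloosterman sum mod p of length ≍ p
(Weil: fine), so the test is the mixed
phase e(h(ν_r − ν_p)p̄/r) at P = R = 10^4 numerically. (3) lookup: any level-of-distribution result
for A_d(x), d ∣ m, with the marked
prime beyond x^{1/2} in Pascadi (arXiv:2404.04239) / GM §1 — I found none (GM p.4: D ≤ X^{1/2−o(1)}
'in the critical ranges').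

NUMBERS. Type-I level for the small-root sequence at K ≍ X: D ≤ X^{1/2−o(1)} (arXiv:2505.00493 Thm
1.4: ≺≺ D X^{1/2}(1+X/D²)^θ, θ = 7/64;
Merikoski2022 Prop. 3 = dlBD: x^{(32−7α)/50−η}, = x^{1/2−η} at α = 1; DI 1982: x^{1−ε}P^{−1/2};
Hooley: x^{1−ε}P^{−3/4}). Type II at
MN ≍ X: N < X^{1/3−o(1)} unconditionally (GM Thm 1.5), N < x^{(57−32α)/96} (Merikoski2022 Prop.
4(i)), N < M^{1/2} for β on primes
(DukeFriedlanderIwaniec1995 Prop. 2: ‖αρ‖‖β‖(M^{1/2} + N^{3/4}M^{3/8+ε})). Ford–Maynard: (γ,θ,ν) =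
(½,0,ν), ⅓ ≤ ν < ½ is a continuity point
for divisor-bounded sequences (Thm 2.5), C^±(P_ε) blows up for general ones (Thm 2.4). Kloosterman
fractions: DFI97 bilinear bound
nontrivial at M = N (saving a fixed power); Bettin–Chandee: (AMN)^{7/20+ε}(M+N)^{1/4} +
(AMN)^{3/8+ε}(AN+AM)^{1/8}, at A = 1, M = N a
saving N^{−1/20}; Fouvry–Radziwiłł Cor. 1.1: level x^{1/2+1/66−ε} with |·| over q for α∗β, β
Siegel–Walfisz of length ≥ exp((log x)^ε).
This route asks: δ > 0 arbitrary but fixed at P = X^{1/2+δ}; window exponent 3/2; Type-II floor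
exp((log X)^{2/3}). Items at open: 12.

DEFINITION REQUESTS. None: everything is typed with Mathlib +
`Literature.NumberTheory.Sieve.polyRootCountMod` / `hardyLittlewoodEConst` /
`HardyLittlewoodConjE` (the branch-restricted root Weyl sum of rank 2 is inlined; `polyRootWeylSum`
exists for the unrestricted one).
Cite-facts wanted (filed as a cite item after open): Grimmelt–Merikoski arXiv:2505.00493 Thm 1.4
(Type I, D ≤ X^{1/2}) and Thm 1.5
(Type II) as Literature named facts, to discharge TypeIBelowHalf by citation and to state
TypeIIPolylog's baseline.

Novelty: Searches (2026-08-15): `lit frontier Parity --since 2020` (30 rows: none on roots of quadratic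
congruences / Kloosterman fractions);
`lit bridges Parity --cross any` (30 rows: none); `lit search --source zbmath "Kloosterman fractions
bilinear level of distribution"` (1:
FouvryRadziwill2022) and `"equidistribution roots quadratic congruences" --year-from 2015` (5: SSZ
arXiv:2009.03460, Blomer 1912.08137,
Welsh 1809.05211, GM 2505.00493, Ngo 2107.13301 — none beyond level ½); `lit search --source arxiv`
(HTTP 429 all session); `lit galaxy
search "Kloosterman fractions" --star all` (9 rows: Surveys in Number Theory 2003, Bagshaw–Kerr
2304.05009, Assing–Blomer–Li 2005.13915,
Young 2208.03358, FI X²+Y⁴ — none on quadratic roots); `lit read` arXiv:1908.08816 pp.3–5 (Merikoski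
Props 3–4, 'even for P = x^{1+ε} …
off by a factor 4'), arXiv:2505.00493 pp.3–5 (Thms 1.4–1.5, ≺≺, outline), arXiv:1811.08672 pp.3–4
(FR Cor. 1.1, DFI97+BC as R*
substitute); `lean search` (polyRootWeylSum, dukeFriedlanderIwaniec1995_proposition1/2,
SiegelWalfiszMoebius_holds,
tendsto_hardyLittlewoodE_partial_holds, HardyLittlewoodConjE); route files
UnimodularColumns/QuadraticRoots and the 15 ledger notes on
stmt-Parity-0648; `ledger negatives --problem Parity` (0); the card's own audit (arXiv 'Kloosterman
fractions' listing, 23 rows; zbMATH).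
Nearest prior art found: DukeFriedlanderIwaniec1997 / BettinChandee2018 (the ℤ-inequalities; BC's
auxiliary C₁(M,N,A) is the un-entangled
model of rank 2), FouvryRadziw  [refs: 2009.03460, 1908.08816, 2505.00493, 1811.08672, FouvryRadziwill2022, DukeFriedlanderIwaniec1997, BettinChandee2018, Merikoski2022, DukeFriedlanderIwaniec1995]

Barriers (technique_class: kloosterman-fractions bilinear-forms dispersion small-roots): - technique_class: kloosterman-fractions bilinear-forms dispersion small-roots
- Literature.Barriers.Parity.LargeSieveLevelHalf: APPLIES to any large-sieve/automorphic-kernel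
proof of ranks 2–3 (level X^{1/2}·L is past Q = √N; GM's D X^{1/2} and DFI95 Prop. 1's (d/M)^{1/20}
are its root-sequence avatars); EVADED by design: DFI97/BC are counting/amplification inequalities
nontrivial at M = N with arbitrary coefficients — the barrier file's own BFI quote names
'dispersion, Fourier analysis and Kloosterman sums … the parameter a forced to be fixed' as the way
past x^{1/2}; here the residues are the roots (structured, not a max over a), and rank 3 is signed
over primes, not |·| over all q. Whether the transplant keeps the M = N property with entangled
numerators is exactly rank 2.
- Literature.Barriers.Parity.FordMaynardMinimalTypeII: not engaged against us: the sieved sequence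
is the MODULUS sequence w_k = a_k(X) − ρ(k)X/k (positive density in k, divisor-bounded), with
Type-II width [exp((log X)^{2/3}), X^{1/3}] supplied by TypeIIPolylog; the glue is FM's continuity
point (½, 0⁺, ⅓) for bounded sequences (Thm 2.5, 'DFI, where positive density was vital'); no lower
bound for primes in the thin set n²+1 is drawn from Type I/II — that content is CofactorLog.
- Literature.Barriers.Parity.FordMaynardLowLevel: same placement; the thin-set dictionary (c = ½ for
values of one quadratic) is respected: HL-E's parity is NOT claimed from (I)/(II); it sits in
CofactorLog, named as the atom.

History (route lifecycle, newest last):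
- 2026-08-15T13:49:56Z · CLOSED retired — not-a-thesis: assembly does not conclude the sub-problem Statement (operator:999:1257524)

sub-problem: BatemanHorn · status: closed(retired) · opened planner-plancard-Parity-BatemanHorn-gaussian--e1a3bbd6-0 2026-08-15T11:52:17Z · rev 0 · ledger route-Parity-KloostermanFractions
GENERATED by the gate from the ledger (D-0016/17). Provers cite these decls: `theorem foo : Summit.Parity.BatemanHorn.Theses.KloostermanFractions.<Decl> := …` in Summits/Parity/BatemanHorn/Theorems/<Name>.lean.
-/

namespace Summit.Parity.BatemanHorn.Theses.KloostermanFractions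

open scoped BigOperators Topology Manifold Classical MeasureTheory ProbabilityTheory Matrix InnerProductSpace ComplexConjugate ContinuousMap
open Filter Set Function TopologicalSpace MeasureTheory

attribute [summit_statement] _root_.BatemanHorn

-- TODO item stmt-Parity-6764 · target · rank 0 · closed · moot by None · by planner — BLOCKED: missing decl(s) CofactorLog, RootLevelBeyondHalf, TypeIIPolylog; restate via `ledger route edit` once they land:
--   def Target : Prop := RootLevelBeyondHalf ∧ TypeIIPolylog ∧ CofactorLog

/-- item stmt-Parity-6765 · crux · rank 2 · closed · moot by None · by planner
why it might fail: The numerator is entangled with BOTH variables (h(ν_r − ν_p)p̄/r): DFI97/BC need a free numerator, and graph-supported numerators can kill all cancellation (a_m = m gives e(1/n)); only the arithmetic of the roots can save it, and the ℤ[i] lattice count may lose R^{1/2}.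
sources: DukeFriedlanderIwaniec1997, BettinChandee2018, FouvryRadziwill2022, arXiv:2604.25177, DukeFriedlanderIwaniec1995, Summits/Parity/BatemanHorn/Ideas/gaussian-kloosterman-fractions-window.md
[crux] ENGINE (card K1, typed over ℤ). ∃ δ > 0: for X ≥ X₀, K ∈ [X^{1−δ}, X^{1+δ}], P ∈ [X^{1/2−δ},
X^{1/2+δ}], K ≤ K' ≤ 2K, 0 ≤ T ≤ X, 1 ≤ t ≤ X^δ, 0 < |h| ≤ X^δ: Σ_{p ∈ (P,2P] prime} Σ_{a mod p, a²
≡ −1} | Σ_{r : t ∣ r, K < pr ≤ K'} Σ_{N mod pr : N² ≡ −1 (pr), N ≡ a (p)} e(h(N − T)/(pr)) | ≤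
K·X^{−δ} (trivial ≍ K/(t log P)). By CRT and reciprocity the phase is e(hν_p r̄/p)·e(hν_r p̄/r) up
to a smooth factor: a bilinear form in Kloosterman FRACTIONS with root numerators, outer variable =
Gaussian prime π (p = N π, a = ι_π(i)), inner variable = primitive Gaussian integer of norm r; |·|
outside = arbitrary coefficients on π: the DFI-1997/Bettin–Chandee shape at the balanced point P ≍
K/P. Implies RootLevelBeyondHalf (support FractionsToTypeI, Vaaler). [difficulty: open-problem] -/
@[route_item "route-Parity-KloostermanFractions"]
def RootFractionsBound : Prop :=
  ∃ δ : ℝ, 0 < δ ∧ ∃ X₀ : ℝ, ∀ X K K' P T : ℝ, ∀ t : ℕ, ∀ h : ℤ, X₀ ≤ X → X ^ (1 - δ) ≤ K → K ≤ X ^ (1 + δ) → K ≤ K' → K' ≤ 2 * K → X ^ (1 / 2 - δ) ≤ P → P ≤ X ^ (1 / 2 + δ) → 0 ≤ T → T ≤ X → 1 ≤ t → (t : ℝ) ≤ X ^ δ → h ≠ 0 → (h.natAbs : ℝ) ≤ X ^ δ → ∑ p ∈ (Finset.Ioc ⌊P⌋₊ ⌊2 * P⌋₊).filter Nat.Prime,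 ∑ a ∈ (Finset.range p).filter (fun a : ℕ => p ∣ a ^ 2 + 1), ‖∑ r ∈ (Finset.Icc 1 ⌊2 * K⌋₊).filter (fun r : ℕ => t ∣ r ∧ K < (p : ℝ) * r ∧ (p : ℝ) * r ≤ K'), ∑ N ∈ (Finset.range (p * r)).filter (fun N : ℕ => p * r ∣ N ^ 2 + 1 ∧ N ≡ a [MOD p]), Complex.exp (2 * ↑Real.pi * Complex.I * ((h : ℂ) * ((N : ℂ) - (T : ℂ)) / ((p : ℂ) * (r : ℂ))))‖ ≤ K * X ^ (-δ)

/-- item stmt-Parity-6766 · crux · rank 3 · closed · moot by None · by planner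
why it might fail: It is the n²+1 analogue of 'primes to prime moduli beyond √x with a fixed residue' (open; BFI reach x^{1/2+o(1)} with |·|, no power); Hooley/DI/dlBD (x^{(32−7α)/50}=x^{1/2} at α=1) and GM (D ≤ X^{1/2−o(1)}) all stop exactly here; a power saving may simply be false at P = X^{1/2+δ}.
sources: arXiv:2505.00493, Merikoski2022, DeshouillersIwaniec1982, BombieriFriedlanderIwaniecActa1986, FordMaynard2024PrimeSieves, DukeFriedlanderIwaniec1995
[crux] INTERFACE (card C3 of unimodular-mobius-gm-continuity, made honest: power room, signed over
primes). ∃ δ > 0: for X ≥ X₀, K ∈ [X^{1−δ}, X^{1+δ}], K ≤ K' ≤ 2K, P ∈ [X^{1/2−δ}, X^{1/2+δ}], P ≤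
P' ≤ 2P, 1 ≤ t ≤ X^δ: | Σ_{p ∈ (P,P'] prime} Σ_{k ∈ (K,K'], pt ∣ k} ( #{1 ≤ ℓ ≤ X : k ∣ ℓ²+1} − X
ρ(k)/k ) | ≤ X^{1−δ}, ρ = polyRootCountMod(X²+1) (trivial ≍ X/log X). Signed level of distribution
X^{1/2+δ} for the small-root sequence over moduli with a marked prime factor of size ≈ √K — the
exact Type-I input the Harman-sieve glue needs for the balanced semiprimes d = (tiny)·q·m'. Every
printed method stops at prime/all moduli ≤ X^{1/2−o(1)}. [deps: RootFractionsBound] [difficulty: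
open-problem] -/
@[route_item "route-Parity-KloostermanFractions"]
def RootLevelBeyondHalf : Prop :=
  ∃ δ : ℝ, 0 < δ ∧ ∃ X₀ : ℝ, ∀ X K K' P P' : ℝ, ∀ t : ℕ, X₀ ≤ X → X ^ (1 - δ) ≤ K → K ≤ X ^ (1 + δ) → K ≤ K' → K' ≤ 2 * K → X ^ (1 / 2 - δ) ≤ P → P ≤ X ^ (1 / 2 + δ) → P ≤ P' → P' ≤ 2 * P → 1 ≤ t → (t : ℝ) ≤ X ^ δ → abs (∑ p ∈ (Finset.Ioc ⌊P⌋₊ ⌊P'⌋₊).filter Nat.Prime, ∑ k ∈ (Finset.Ioc ⌊K⌋₊ ⌊K'⌋₊).filter (fun k : ℕ => p * t ∣ k), (((((Finset.Icc 1 ⌊X⌋₊).filter (fun ℓ : ℕ => k ∣ ℓ ^ 2 + 1)).card : ℕ) : ℝ) - X * (Literature.NumberTheory.Sieve.polyRootCountMod ![(Polynomial.X ^ 2 + 1 : Polynomial ℤ)] k : ℝ) / k)) ≤ X ^ (1 - δ)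

/-- item stmt-Parity-6767 · crux · rank 4 · closed · moot by None · by planner
why it might fail: GM absorb the modulus average by a POINTWISE divisor bound (their ≺≺ hides X^{o(1)} = exp(O(log X/log log X))); polylog losses need divisor sums on average inside the automorphic-kernel count, uniformly for N as small as exp((log X)^{2/3}) — may fail structurally.
sources: arXiv:2505.00493, Merikoski2022, DukeFriedlanderIwaniec1995
[crux] Grimmelt–Merikoski's Type II (arXiv:2505.00493 Thm 1.5, h = a = 1) with POLYLOG losses down
to tiny N: ∀ A, C > 0 ∃ B, X₀: for X ≥ X₀, K ∈ [X(log X)^{−C}, X(log X)^{C}], exp((log X)^{2/3}) ≤ N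
≤ X^{1/3}(log X)^{−B}, MN = K, real 1-bounded α, β supported on squarefrees: | Σ_{m ~ M} Σ_{n ~ N}
α_m β_n ( #{ℓ ≤ X : mn ∣ ℓ²+1} − Xρ(mn)/(mn) ) | ≤ X(log X)^{−A}. GM give ≺≺ M^{1/2}X^{1/2} +
M^{1/4}NX^{1/2}(1 + X/(M^{1/2}N²))^θ, i.e. saving min(N^{1/2}, (X/N³)^{c}) up to X^{o(1)}; the crux
is to make the loss (log X)^{O(1)} (or anything below exp(½(log X)^{2/3})). [difficulty: L] -/
@[route_item "route-Parity-KloostermanFractions"]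
def TypeIIPolylog : Prop :=
  ∀ A : ℝ, 0 < A → ∀ C : ℝ, 0 < C → ∃ B : ℝ, ∃ X₀ : ℝ, ∀ X K M N : ℝ, ∀ α β : ℕ → ℝ, X₀ ≤ X → X / Real.log X ^ C ≤ K → K ≤ X * Real.log X ^ C → Real.exp (Real.log X ^ (2 / 3 : ℝ)) ≤ N → N ≤ X ^ (1 / 3 : ℝ) / Real.log X ^ B → M * N = K → (∀ m, abs (α m) ≤ 1) → (∀ n, abs (β n) ≤ 1) → (∀ m, ¬Squarefree m → α m = 0) → (∀ n, ¬Squarefree n → β n = 0) → abs (∑ m ∈ Finset.Ioc ⌊M⌋₊ ⌊2 * M⌋₊, ∑ n ∈ Finset.Ioc ⌊N⌋₊ ⌊2 * N⌋₊, α m * β n * (((((Finset.Icc 1 ⌊X⌋₊).filter (fun ℓ : ℕ => m * n ∣ ℓ ^ 2 + 1)).card : ℕ) : ℝ) - X * (Literature.NumberTheory.Sieve.polyRootCountMod ![(Polynomial.X ^ 2 + 1 : Polynomial ℤ)] (m * n) : ℝ) / ((m : ℝ) * n))) ≤ X / Real.log X ^ A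

/-- item stmt-Parity-6768 · crux · rank 5 · closed · moot by None · by planner
why it might fail: It is the parity atom: μ of the cofactor (n²+1)/e ≥ x(log x)^C along ρ(e) root classes with (log x)^{2+δ} saving over trivial — Chowla-type for an irreducible quadratic; no Type-I/II mechanism exists (FordMaynardLowLevel, c = 1/2); only F_q[t] analogues are known.
sources: SawinShusterman2022, Harman2007, FordMaynard2024PrimeSieves, Literature.Barriers.Parity.SelbergParityBarrier, Literature.Barriers.Parity.FordMaynardLowLevel
[crux] The parity atom, correctly quantified (replaces the vacuous stmt-Parity-0649 shape: here C, δ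
are coupled to nothing else and every admissible C leaves inner sums of length ≥ (log x)^C ρ(e)): ∃
C ≥ 0, δ > 0, x₀: for x ≥ x₀, Σ_{e ≤ 2x(log x)^{−C}} | Σ_{n ≤ x, e ∣ n²+1, n²+1 > e·x(log x)^C}
μ((n²+1)/e) | ≤ x(log x)^{−1−δ} (trivial ≍ x log x; random model needs C > 2 + 2δ). Covers every
divisor d = (n²+1)/e above the log-window, including the near-diagonal range d ∈ [x(log x)^C,
x^{1+η}] that (W) of QuadraticRoots assigned to the modulus side. [difficulty: open-problem] -/
@[route_item "route-Parity-KloostermanFractions"]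
def CofactorLog : Prop :=
  ∃ C : ℝ, 0 ≤ C ∧ ∃ δ : ℝ, 0 < δ ∧ ∃ x₀ : ℝ, ∀ x : ℝ, x₀ ≤ x → ∑ e ∈ Finset.Icc 1 ⌊2 * x / Real.log x ^ C⌋₊, abs (∑ n ∈ (Finset.Icc 1 ⌊x⌋₊).filter (fun n : ℕ => e ∣ n ^ 2 + 1 ∧ (e : ℝ) * x * Real.log x ^ C < (n : ℝ) ^ 2 + 1), (ArithmeticFunction.moebius ((n ^ 2 + 1) / e) : ℝ)) ≤ x / Real.log x ^ (1 + δ)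

/-- item stmt-Parity-6769 · support · rank 9 · closed · moot by None · by planner
sources: arXiv:2505.00493, Merikoski2022, DeshouillersIwaniec1982, Hooley1976
[support] Type I BELOW the diagonal, sharp form of Grimmelt–Merikoski Thm 1.4 (h = a = 1; also de la
Bretèche–Drappeau = Merikoski2022 Prop. 3 at α = 1): ∀ ε > 0 ∃ δ > 0, X₀: for X ≥ X₀, K ∈ [X^{1−δ},
X^{1+δ}], K ≤ K' ≤ 2K, 1 ≤ D ≤ X^{1/2−ε}: Σ_{d ≤ D} | Σ_{k ∈ (K,K'], d ∣ k} ( #{ℓ ≤ X : k ∣ ℓ²+1} −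
Xρ(k)/k ) | ≤ X^{1−δ}. In print (GM: ≺≺ D X^{1/2}(1+X/D²)^θ, θ = 7/64); sharp ↔ smooth cutoffs cost
X^{1−δ'}. To be vendored as a Literature named fact and used as hypothesis; needed by the glue for
the tiny Legendre moduli and for marked primes q ≤ X^{1/2−ε}. [difficulty: L] -/
@[route_item "route-Parity-KloostermanFractions"]
def TypeIBelowHalf : Prop :=
  ∀ ε : ℝ, 0 < ε → ∃ δ : ℝ, 0 < δ ∧ ∃ X₀ : ℝ, ∀ X K K' D : ℝ, X₀ ≤ X → X ^ (1 - δ) ≤ K → K ≤ X ^ (1 + δ) → K ≤ K' → K' ≤ 2 * K → 1 ≤ D → D ≤ X ^ (1 / 2 - ε) → ∑ d ∈ Finset.Icc 1 ⌊D⌋₊, abs (∑ k ∈ (Finset.Ioc ⌊K⌋₊ ⌊K'⌋₊).filter (fun k : ℕ => d ∣ k), (((((Finset.Icc 1 ⌊X⌋₊).filter (fun ℓ : ℕ => k ∣ ℓ ^ 2 + 1)).card : ℕ) : ℝ) - X * (Literature.NumberTheory.Sieve.polyRootCountMod ![(Polynomial.X ^ 2 + 1 : Polynomial ℤ)] k :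 ℝ) / k)) ≤ X ^ (1 - δ)

/-- item stmt-Parity-6770 · support · rank 9 · closed · moot by None · by planner
sources: MontgomeryVaughan2007, BatemanHorn1962, Literature.NumberTheory.LFunctions.SiegelWalfiszMoebius_holds, Literature.NumberTheory.Sieve.tendsto_hardyLittlewoodE_partial_holds
[support] PNT(ℚ(i))-strength main-term inputs, ρ = polyRootCountMod(X²+1): ∀ A > 0 ∃ C: for y ≥ 2,
|Σ_{d ≤ y} μ(d)ρ(d)/d| ≤ C(log y)^{−A} and |Σ_{d ≤ y} μ(d)ρ(d) log d/d + hardyLittlewoodEConst| ≤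
C(log y)^{−A} (Σ_d μ(d)ρ(d)d^{−s} = ∏_p(1 − ρ(p)p^{−s}) = E(s)/ζ(s), E(1) = ordered ∏_p
(1−1/p)^{−1}(1−ρ(p)/p) = hardyLittlewoodEConst; μρ = μ·(1∗χ₋₄) on odd squarefrees, so both follow
from Literature.NumberTheory.LFunctions.SiegelWalfiszMoebius_holds by the hyperbola method + Abel
summation). Provable now (laborious). [difficulty: provable-now] -/
@[route_item "route-Parity-KloostermanFractions"]
def RootMainTerms : Prop :=
  ∀ A : ℝ, 0 < A → ∃ C : ℝ, ∀ y : ℝ, 2 ≤ y → abs (∑ d ∈ Finset.Icc 1 ⌊y⌋₊, (ArithmeticFunction.moebius d : ℝ) * (Literature.NumberTheory.Sieve.polyRootCountMod ![(Polynomial.X ^ 2 + 1 : Polynomial ℤ)] d : ℝ) / d) ≤ C / Real.log y ^ A ∧ abs (∑ d ∈ Finset.Icc 1 ⌊y⌋₊, (ArithmeticFunction.moebius d : ℝ) * (Literature.NumberTheory.Sieve.polyRootCountMod ![(Polynomial.X ^ 2 + 1 : Polynomial ℤ)] d : ℝ) * Real.log d / d + Literature.NumberTheory.Sieve.hardyLittlewoodEConst)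 ≤ C / Real.log y ^ A

/-- item stmt-Parity-6771 · support · rank 9 · closed · moot by None · by planner
sources: FordMaynard2024PrimeSieves, arXiv:2505.00493, Harman2007, DukeFriedlanderIwaniec1995
[support] The LOG-window Möbius statement (the part of (W) this route makes precise), all heights,
sub-dyadic: ∀ C > 0 ∃ x₀: for x ≥ x₀, x(log x)^{−C} ≤ D ≤ x(log x)^{C}, D ≤ D' ≤ 2D: | Σ_{D<d≤D'}
μ(d)( #{n ≤ x : d ∣ n²+1} − xρ(d)/d ) | ≤ x(log x)^{−3/2}. Exponent 3/2 (not all A): the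
Harman-sieve boundary slivers at X^{1/3±o(1)} cost x(log log x)²/(log x)², and 3/2 suffices for HL-E
because the window has only O(log log x) dyadic blocks. Follows from RootLevelBeyondHalf +
TypeIIPolylog + TypeIBelowHalf (support WindowFromTypeInfo); qualitatively (o(x)) it is GM +
Ford–Maynard continuity at (½, 0, ⅓). [difficulty: L] -/
@[route_item "route-Parity-KloostermanFractions"]
def LogWindow : Prop :=
  ∀ C : ℝ, 0 < C → ∃ x₀ : ℝ, ∀ x D D' : ℝ, x₀ ≤ x → x / Real.log x ^ C ≤ D → D ≤ x * Real.log x ^ C → D ≤ D' → D' ≤ 2 * D → abs (∑ d ∈ Finset.Ioc ⌊D⌋₊ ⌊D'⌋₊, (ArithmeticFunction.moebius d : ℝ) * (((((Finset.Icc 1 ⌊x⌋₊).filter (fun n : ℕ => d ∣ n ^ 2 + 1)).card : ℕ) : ℝ) - x * (Literature.NumberTheory.Sieve.polyRootCountMod ![(Polynomial.X ^ 2 + 1 : Polynomial ℤ)] d : ℝ) / d)) ≤ x / Real.log x ^ (3 / 2 : ℝ)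

/-- item stmt-Parity-6772 · support · rank 9 · closed · moot by None · by planner
sources: Vaaler1985, MontgomeryVaughan2007, Hooley1976
[support] Dual ⇒ primal (card K2): RootFractionsBound → RootLevelBeyondHalf. #{ℓ ≤ X : ℓ ≡ N (k)} −
X/k = ψ(−N/k) − ψ((X−N)/k) exactly (ρ(k)X/k is the exact mean; roots pair N ↔ k−N),
Vaaler/Erdős–Turán truncation at H = X^{2δ'} (tail ≪ K/(tH)), frequencies e(h(N−T)/k) for T ∈ {0, X}
= the T-twist of the crux, splitting by the root a mod p and the triangle inequality; sub-dyadic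
(P,P'], (K,K'] by differencing/short ranges at power cost. [difficulty: M] -/
@[route_item "route-Parity-KloostermanFractions"]
def FractionsToTypeI : Prop :=
  RootFractionsBound → RootLevelBeyondHalf

/-- item stmt-Parity-6773 · support · rank 9 · closed · moot by None · by planner
sources: Harman2007, FordMaynard2024PrimeSieves, DukeFriedlanderIwaniec1995, arXiv:2505.00493
[support] Harman-sieve glue (card K4): RootLevelBeyondHalf → TypeIIPolylog → TypeIBelowHalf →
LogWindow. Decompose squarefree d ~ D ≍ x(log x)^{±C} by factorisation type with z = exp((log
X)^{2/3}): a sub-product in [z, X^{1/3}(log X)^{−B}] ⇒ Type II (coupling P⁻(m) ≥ q removed on (log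
X)^{A+1} short q-ranges); else d = s·(≤ 3 primes > X^{1/3}(log)^{−B}), s < z: one prime ⇒ sieve it
(Legendre to z truncated at z^{10 log log X} by Rankin: TypeIBelowHalf; Buchstab primes in the
Type-II range: Type II; larger ⇒ two primes); two primes q ≤ m' ⇒ modulus s·e'·q with q ≤
√K(log)^{C/2} ≤ X^{1/2+δ}: RootLevelBeyondHalf (signed over prime q, |·| over the X^{o(1)} tiny
parts) or TypeIBelowHalf when q ≤ X^{1/2−ε}; three primes ≍ X^{1/3} ⇒ boundary sliver of mass ≪
x(log log x)²/(log x)² < x(log x)^{−3/2}. Positive density/divisor-boundedness of a_k is what makes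
(½, 0⁺, ⅓) work (FM Thm 2.5, 'DFI where positive density was vital'). [difficulty: XL] -/
@[route_item "route-Parity-KloostermanFractions"]
def WindowFromTypeInfo : Prop :=
  RootLevelBeyondHalf → TypeIIPolylog → TypeIBelowHalf → LogWindow

/-- item stmt-Parity-6774 · support · rank 9 · closed · moot by None · by planner
sources: BatemanHorn1962, Hooley1976, MontgomeryVaughan2007, Literature.NumberTheory.Sieve.tendsto_hardyLittlewoodE_partial_holds
[support] HL-E bookkeeping: LogWindow → CofactorLog → RootMainTerms → HardyLittlewoodConjE. With Y =
x(log x)^C (C from CofactorLog): Σ_{n≤x} Λ(n²+1) = Σ_{d≤Y} μ(d) Σ_{n≤x, d∣n²+1} log((n²+1)/d) +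
Σ_{n≤x} Σ_{e∣n²+1, n²+1>eY} μ((n²+1)/e) log e; second part ≤ log x · CofactorLog-sum = o(x); first
part: d ≤ x(log x)^{−4} trivially (|r_d(t)| ≤ 2ρ(d)), d ∈ log-window by LogWindow at heights t ∈
[x(log x)^{−4}, x] (partial summation of log(t²+1), sub-dyadic blocks against log d; O(log log x)
blocks × O(x(log x)^{−1/2})) and Σ_{n≤t} τ(n²+1) ≪ t(log t)² below; main terms x·Σ_{d≤Y} μρ/d·(2 log
x + O(1)) − x Σ_{d≤Y} μρ log d/d = Hx + o(x) by RootMainTerms, H = hardyLittlewoodEConst; then Λ →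
prime count by partial summation (prime powers negligible), and HardyLittlewoodConjE with C =
hardyLittlewoodEConst via tendsto_hardyLittlewoodE_partial_holds. [difficulty: L] -/
@[route_item "route-Parity-KloostermanFractions"]
def HLEFromLogWindow : Prop :=
  LogWindow → CofactorLog → RootMainTerms → Literature.NumberTheory.Sieve.HardyLittlewoodConjE

/-- item stmt-Parity-6775 · assembly · rank 1 · closed · moot by None · by planner
sources: BatemanHorn1962, Harman2007, FordMaynard2024PrimeSieves, arXiv:2505.00493
[assembly] RootLevelBeyondHalf → TypeIIPolylog → CofactorLog → TypeIBelowHalf → RootMainTerms →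
HardyLittlewoodConjE (Harman-sieve glue on the log-window + Λ = μ∗log bookkeeping; =
HLEFromLogWindow ∘ WindowFromTypeInfo). -/
@[route_item "route-Parity-KloostermanFractions"]
def Assembly : Prop :=
  RootLevelBeyondHalf → TypeIIPolylog → CofactorLog → TypeIBelowHalf → RootMainTerms → Literature.NumberTheory.Sieve.HardyLittlewoodConjE

end Summit.Parity.BatemanHorn.Theses.KloostermanFractions
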